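import Summits.BirchSwinnertonDyer.BirchSwinnertonDyer.Theorems.SignedLowerHalvesSprungLowerHalfAtThreeChromaticCongruence
import HarnessLib

/-!
# Route `SignedLowerHalves`, crux `SprungLowerHalfAtThree` (item stmt-BirchSwinnertonDyer-19003): the
# ANALYTIC ♯/♭ ↔ ± transfer along a mod-`p` congruence as a KERNEL THEOREM — Sprung pairs attached to
# mod-`(p, ω_n)`-congruent (Σ-imprimitive) Mazur–Tate sequences are congruent mod `pΛ`, so `μ = 0` and the
# Σ-imprimitive `λ` pass between the curves (cell `bsd-ssimc`, seat `bsd-ssimc-k3-c5` gen 6, object «L5-AN»,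
# planner ruling D21-1; part 2 of 2; a `--supports … --as helper` file, closes nothing)

PARTITION (cell bsd-ssimc): X8 (A8) × the 61 non-surjective (3Nn) window cells = crux 5's line of record
L5-CM (`CorpuzLei2025_sharpFlatMainConjecture_transfer_OPEN.lean`, p427325; 37 CM-EC-partnered) and, at
`a₁ = a₂ = 0`, item 4's L4-CM — types-the-object-of; closes NONE; nothing booked; BSD is not proved by any of
this. bears_on: K3 (route-BirchSwinnertonDyer-SignedLowerHalves item 5). THEOREMS ONLY: no `def`, no named
fact, no PRE binder; nothing about any curve is asserted.

## What is proved (modulo ONE displayed hypothesis `hMT`, below)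

The cell's «CM-congruence transfer» lines consume the preprint Corpuz–Lei (arXiv:2508.09733, 2025) as ONE
open binder (p427325 / p422273: Thms 1 + 2 + 3 composed). Its ANALYTIC third — Thm. 1 = Thm. 5.3 with
Thm. 4.5: for `p`-congruent non-ordinary `f, g` (`p ≥ 3`, weight `k < p`, unramified coefficients,
`ord_p a_p > 0`), `L_{p,Σ₀}(f, ♮) ≡ L_{p,Σ₀}(g, ♮) (mod p)`, `♮ ∈ {♯, ♭}`, hence `μ^♮_an(f) = 0 ⟺ μ^♮_an(g) = 0`
and equal Σ₀-imprimitive `λ` — is proved there through the Büyükboduk–Lei logarithm matrix. HERE it is a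
theorem of the tree, `α`-free, on Sprung's MAZUR–TATE characterisation `IsSprungPair f p a_p L♯ L♭`
(`θ_n ≡ −(u_n L♯ + v_n L♭) (mod ω_n)`), using part 1's Λ-lemma `ChromaticCongruence.C_dvd_sub_of_sprung_congr`:
* §5 `sprung_congr_of_isSprungPair_of_mazurTate_congr`: two Sprung pairs (any levels, any traces) + `hMT`
  give part 1's hypothesis for `Aᵢ = L♯ᵢ·Pᵢ`, `Bᵢ = L♭ᵢ·Pᵢ` (the `p`-power slack of the rational
  congruences `IsCongrModOmega` is removed by `exists_eq_omega_mul_of_C_pow_mul_eq`: `ω_n ↦ T^{pⁿ} ≠ 0`).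
* §6 `C_dvd_sub_of_isSprungPair_of_mazurTate_congr` (≙ CL Thm. 4.5 at `k = 2`, `ω⁰`, `r = 1`; `p ∣ a₁, a₂`):
  `L♯₁P₁ ≡ c·L♯₂P₂`, `L♭₁P₁ ≡ c·L♭₂P₂ (mod pΛ)`; `hasUnitContent_chromaticL_iff_of_mazurTate_congr`,
  `lam_chromaticL_mul_eq_of_mazurTate_congr` (≙ CL Thm. 5.3: `μ = 0` passes; Σ-imprimitive `λ`'s agree).
* §7 the cell's currency: `chromaticL_ne_zero_and_mu_eq_zero_of_partner_of_mazurTate_congr`,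
  `signedMuVanishing_of_partner_of_mazurTate_congr` (`SignedMuVanishing W₂ p ⟹ SignedMuVanishing W₁ p` for
  `p ∣ a_p(W₁)`, `GoodSS W₂ p`, conductor-level newforms) and `X8.signedMuVanishing_of_partner_of_mazurTate_congr`.
  In L5-CM (`W₂` = a `3`-congruent CM curve, `a_3 = 0`; node a THEOREM in the 10 unit-case cells, p432145,
  two-engine certified in the other 27, kit j251242 / j252628): `μ(L♯_3(E)) = μ(L♭_3(E)) = 0` for the X8
  curve follows IN THE KERNEL modulo `hMT` (+ the certified node off the unit case).

## The displayed hypothesis `hMT` (never asserted, never discharged here)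

`hMT : ∀ n, ∃ q r ∈ Λ, θ_n(f₁)·ι P₁ − ι(c)·θ_n(f₂)·ι P₂ = ι(ω_n·q + p·r)` in `ℚ_p⟦T⟧` — the Σ-IMPRIMITIVE
Mazur–Tate elements of `f₁` and `f₂` (multipliers `P₁, P₂ ∈ Λ` of unit content = the Euler-factor
depletions at `Σ₀ = primes of N₁N₂`; `c ∈ ℤ_pˣ` = the period unit) are congruent mod `(p, ω_n)` and in
particular `p`-integral (PRIMITIVE elements of different levels are NOT congruent in general: the Euler
factors at `Σ₀` differ, whence the multipliers and the `λ`-statement about `L•ᵢ·Pᵢ`). IN PRINT (S-classes):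
* Corpuz–Lei arXiv:2508.09733 (PRE), §2.2 eq. (congruence of `φ_F^±`, `φ_G^±` for the Σ₀-depletions
  `F, G`, cohomological periods) and Prop. 4.2 «`P_{Σ₀,n}(f,ωⁱ) ≡ P_{Σ₀,n}(g,ωⁱ) mod p^r·ω_{n,k−1}·𝒪[X]`»
  under Assumptions 1–3 («`p ≥ 3`», «`p > k`», «`E/ℚ_p` unramified»): `p = 3`, `k = 2`, `𝒪 = ℤ_3`,
  both forms NON-ordinary at `3` — **inside the printed scope (PRE)**; this is `hMT` with `c = 1` after
  their period normalisation (their text, p. 8: «Without loss of generality, we can take `u_f^± = u_g^± = 1`»).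
* Its printed inputs are PUBLISHED and in scope at `p = 3`, `k = 2`: multiplicity one
  `H¹_P(Γ, L_{k−2}(𝒪))^±_𝔪 ≅ S_k(Γ, 𝒪)_𝔪` «a consequence of [FJ95] provided `p ∤ M` and `p > k`»
  (Faltings–Jordan, Israel J. Math. 90 (1995); `M` divisible only by `Σ₀`-primes, `3 ∉ Σ₀`), boundary
  symbols Eisenstein (Greenberg–Stevens 1993), Ihara's lemma for the period comparison `f ↔ F`
  (Diamond–Flach–Guo 2004, «`p ∤ M` and `p > k`»).
* Vatsal, Duke Math. J. 98 (1999) Thm. 1.10 — NOT HELD by the cell (acquisition filed 2026-08-26); per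
  Corpuz–Lei §1 its frame is «Suppose that `f` and `g` are `p`-ordinary» ⇒ **«hMT @ 3 ss: outside printed
  scope (as reported)»**; Emerton–Pollack–Weston, Invent. Math. 163 (2006) §3 — read first-hand
  (`paper:arxiv-math_0404484`): `p`-ordinary, `p`-distinguished Hida families throughout ⇒ **«@ 3 ss:
  outside printed scope»**; Greenberg–Vatsal 2000 Rem. 3.4 (Néron vs canonical period a `p`-unit at an
  irreducible odd good `p`) — an ordinary-setting paper whose remark the cell already applies at
  supersingular `p` (docstrings of p427325 / p422273); here it only names the unit `c`.
So for the 61 3Nn X8 window cells (both curves supersingular at 3): `hMT` is PRE-claimed (Corpuz–Lei §2 /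
Prop. 4.2) with published ingredients in scope; no refereed source prints it at a supersingular prime.

## What this is NOT

Not the IMC transfer (Corpuz–Lei Thm. 3 / 5.10 stays PRE in p427325), not the ALGEBRAIC half
(Hatley–Lei, Ann. Inst. Fourier 69 (2019) §4.2, published, untyped; Kim 2009 Cor. 2.13 at `a₁ = a₂ = 0` =
k3-c4's L4-PUB), not `hMT`, not a move on crux 5 (OPEN: `SprungLowerHalfAtThree` ⟺ Modularity-on-X8 ∧
(conv₀) ∧ (low₀), p421771), not a booking, not a claim that `L♯, L♭` of any curve have `μ = 0`.

References: [CorpuzLei2025] §1 Assumptions 1–5, §2.2, Prop. 2.4, Prop. 4.2, Thm. 4.5, Thm. 5.3; [Sprung2017]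
Thm. 1.12, §4 Cor. 4.4; [Pollack2003] Prop. 6.18; [GreenbergVatsal2000] p. 2 (1)–(2), Rem. 3.4;
[EmertonPollackWeston2005] §3; [PerrinRiou2003] Conj. 6.1.1; Faltings–Jordan 1995; Diamond–Flach–Guo 2004. Memo:
`HOME/bsd-ssimc-k3-c5-MEMO-6.md`.
-/

set_option autoImplicit false
set_option linter.dupNamespace false

noncomputable section

open scoped MatrixGroups ModularForm

open CongruenceSubgroup Polynomial Literature.NumberTheory.EllipticCurves
  Literature.NumberTheory.EllipticCurves.ModularForms
  Literature.NumberTheory.EllipticCurves.Sprung2017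
  Literature.NumberTheory.EllipticCurves.GreenbergVatsal2000
  Summit.BirchSwinnertonDyer.Rank1Residual.X1.MuLambda
  Summit.BirchSwinnertonDyer.Rank1Residual.X11a
  Summit.BirchSwinnertonDyer.Rank1Residual.Supersingular
  Literature.NumberTheory.EllipticCurves.Rank1Residual

namespace Summit.BirchSwinnertonDyer.BirchSwinnertonDyer.Theorems

namespace ChromaticCongruence

variable {p : ℕ} [hp : Fact p.Prime]

/-! ### §5 From two Sprung pairs and a congruence of Mazur–Tate elements -/

/-- `toIwasawa q` is the polynomial `q` with coefficients mapped to `ℤ_p`, viewed in `Λ`. [folklore] -/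
private theorem toIwasawa_eq_coe_map (q : ℤ[X]) :
    toIwasawa p q = ((q.map (Int.castRingHom ℤ_[p]) : ℤ_[p][X]) : PowerSeries ℤ_[p]) := rfl

/-- `ι(p^m) = p^m` for `ι : Λ ↪ ℚ_p⟦T⟧`. [folklore] -/
private theorem iwasawaToPowerSeries_C_pow' (m : ℕ) :
    iwasawaToPowerSeries p (PowerSeries.C ((p : ℤ_[p]) ^ m)) = PowerSeries.C ((p : ℚ_[p]) ^ m) := by
  rw [iwasawaToPowerSeries, PowerSeries.map_C, map_pow, map_natCast]

/-- **`p^M · x ∈ ω_n Λ ⇒ x ∈ ω_n Λ`**: `ω_n ↦ T^{pⁿ} ≠ 0` in the domain `𝔽_p⟦T⟧`, so `ω_n` is prime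
to `p` in `Λ` (induction on `M`). [folklore] -/
theorem exists_eq_omega_mul_of_C_pow_mul_eq (n : ℕ) :
    ∀ (M : ℕ) {x y : IwasawaAlgebra p},
      PowerSeries.C ((p : ℤ_[p]) ^ M) * x = toIwasawa p (cyclotomicOmega p n) * y →
      ∃ y' : IwasawaAlgebra p, x = toIwasawa p (cyclotomicOmega p n) * y' := by
  intro M
  induction M with
  | zero =>
    intro x y h
    exact ⟨y, by simpa using h⟩
  | succ M ih =>
    intro x y h
    -- `ȳ = 0`: reduce mod `p`
    have hy : PowerSeries.map (PadicInt.toZMod (p := p)) y = 0 := by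
      have h' := congrArg (PowerSeries.map (PadicInt.toZMod (p := p))) h
      rw [map_mul, map_mul, PowerSeries.map_C, map_pow, map_natCast, ZMod.natCast_self,
        zero_pow (Nat.succ_ne_zero M), map_zero, zero_mul, map_toZMod_cyclotomicOmega] at h'
      exact (mul_eq_zero.mp h'.symm).resolve_left (pow_ne_zero _ PowerSeries.X_ne_zero)
    obtain ⟨y₁, rfl⟩ := (map_toZMod_eq_zero_iff y).mp hy
    have hC0 : (PowerSeries.C (p : ℤ_[p]) : IwasawaAlgebra p) ≠ 0 := by
      intro h0
      have h1 : (p : ℤ_[p]) = 0 := PowerSeries.C_injective (h0.trans (map_zero _).symm)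
      exact hp.out.ne_zero (by exact_mod_cast h1)
    have h2 : PowerSeries.C (p : ℤ_[p]) * (PowerSeries.C ((p : ℤ_[p]) ^ M) * x) =
        PowerSeries.C (p : ℤ_[p]) * (toIwasawa p (cyclotomicOmega p n) * y₁) := by
      rw [← mul_assoc, ← map_mul, ← pow_succ', h]
      ring
    exact ih (mul_left_cancel₀ hC0 h2)

/-- **Two Sprung pairs + a mod-(p, ω_n) congruence of (Σ-imprimitive) Mazur–Tate elements give the
hypothesis of `C_dvd_sub_of_sprung_congr`.** For weight-two forms `f₁, f₂`, traces `a₁, a₂`, Sprung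
pairs `(L♯ᵢ, L♭ᵢ)` (`IsSprungPair fᵢ p aᵢ`: `θ_n(fᵢ) ≡ −(u_n(aᵢ) L♯ᵢ + v_n(aᵢ) L♭ᵢ) (mod ω_n)` in
`Λ ⊗ ℚ_p`), multipliers `P₁, P₂ ∈ Λ` and `c ∈ ℤ_p`: IF `θ_n(f₁)·P₁ − c·θ_n(f₂)·P₂ ∈ (p, ω_n)Λ`
for all `n` (hypothesis `hMT`), THEN for all `n`
`u_n(a₁)(L♯₁P₁) + v_n(a₁)(L♭₁P₁) − c·(u_n(a₂)(L♯₂P₂) + v_n(a₂)(L♭₂P₂)) ∈ (p, ω_n)Λ`.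
The `p`-power slack of the rational congruences is removed by `exists_eq_omega_mul_of_C_pow_mul_eq`.
[cite: Sprung2017, §4 Cor. 4.4 and Thm. 1.12] [cite: Pollack2003, Prop. 6.18 (shape of the congruences)] -/
theorem sprung_congr_of_isSprungPair_of_mazurTate_congr {N₁ N₂ : ℕ}
    (f₁ : CuspForm (Gamma0 N₁) 2) (f₂ : CuspForm (Gamma0 N₂) 2) {a₁ a₂ : ℤ}
    {Ls₁ Lf₁ Ls₂ Lf₂ : IwasawaAlgebra p} (h₁ : IsSprungPair f₁ p a₁ Ls₁ Lf₁)
    (h₂ : IsSprungPair f₂ p a₂ Ls₂ Lf₂) (P₁ P₂ : IwasawaAlgebra p) (c : ℤ_[p])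
    (hMT : ∀ n : ℕ, ∃ q r : IwasawaAlgebra p,
      ((mazurTateElement f₁ p n).map (algebraMap ℚ ℚ_[p]) : PowerSeries ℚ_[p]) *
            iwasawaToPowerSeries p P₁ -
          iwasawaToPowerSeries p (PowerSeries.C c) *
            (((mazurTateElement f₂ p n).map (algebraMap ℚ ℚ_[p]) : PowerSeries ℚ_[p]) *
              iwasawaToPowerSeries p P₂) =
        iwasawaToPowerSeries p
          (toIwasawa p (cyclotomicOmega p n) * q + PowerSeries.C (p : ℤ_[p]) * r))
    (n : ℕ) :
    ∃ q r : IwasawaAlgebra p,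
      toIwasawa p (sharpPoly a₁ p n) * (Ls₁ * P₁) + toIwasawa p (flatPoly a₁ p n) * (Lf₁ * P₁) -
          PowerSeries.C c *
            (toIwasawa p (sharpPoly a₂ p n) * (Ls₂ * P₂) +
              toIwasawa p (flatPoly a₂ p n) * (Lf₂ * P₂)) =
        toIwasawa p (cyclotomicOmega p n) * q + PowerSeries.C (p : ℤ_[p]) * r := by
  obtain ⟨m₁, q₁, e₁⟩ := h₁ n
  obtain ⟨m₂, q₂, e₂⟩ := h₂ n
  obtain ⟨q₀, r₀, e₀⟩ := hMT n
  have hneg : (((-1 : ℤ[X]).map (Int.castRingHom ℤ_[p]) : ℤ_[p][X]) : PowerSeries ℤ_[p]) = -1 := by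
    rw [Polynomial.map_neg, Polynomial.map_one, Polynomial.coe_neg, Polynomial.coe_one]
  rw [hneg, ← toIwasawa_eq_coe_map] at e₁ e₂
  set S₁ : IwasawaAlgebra p :=
    toIwasawa p (sharpPoly a₁ p n) * Ls₁ + toIwasawa p (flatPoly a₁ p n) * Lf₁ with hS₁
  set S₂ : IwasawaAlgebra p :=
    toIwasawa p (sharpPoly a₂ p n) * Ls₂ + toIwasawa p (flatPoly a₂ p n) * Lf₂ with hS₂
  set Ω : IwasawaAlgebra p := toIwasawa p (cyclotomicOmega p n) with hΩ
  -- the integral combination: `p^{m₁+m₂} · (S₁P₁ − c S₂P₂ + p r₀) ∈ Ω Λ`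
  have key : iwasawaToPowerSeries p (PowerSeries.C ((p : ℤ_[p]) ^ (m₁ + m₂)) *
        (S₁ * P₁ - PowerSeries.C c * (S₂ * P₂) + PowerSeries.C (p : ℤ_[p]) * r₀)) =
      iwasawaToPowerSeries p (Ω * (PowerSeries.C ((p : ℤ_[p]) ^ m₂) * q₁ * P₁ -
        PowerSeries.C c * PowerSeries.C ((p : ℤ_[p]) ^ m₁) * q₂ * P₂ -
        PowerSeries.C ((p : ℤ_[p]) ^ (m₁ + m₂)) * q₀)) := by
    simp only [map_mul, map_add, map_sub, map_neg, map_one, iwasawaToPowerSeries_C_pow',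
      pow_add] at e₁ e₂ e₀ ⊢
    linear_combination (PowerSeries.C ((p : ℚ_[p]) ^ m₂) * iwasawaToPowerSeries p P₁) * e₁ -
      (iwasawaToPowerSeries p (PowerSeries.C c) * PowerSeries.C ((p : ℚ_[p]) ^ m₁) *
        iwasawaToPowerSeries p P₂) * e₂ -
      (PowerSeries.C ((p : ℚ_[p]) ^ m₁) * PowerSeries.C ((p : ℚ_[p]) ^ m₂)) * e₀
  obtain ⟨y', hy'⟩ := exists_eq_omega_mul_of_C_pow_mul_eq n (m₁ + m₂)
    (iwasawaToPowerSeries_injective p key)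
  refine ⟨y', -r₀, ?_⟩
  rw [hS₁, hS₂] at hy'
  linear_combination hy'

/-! ### §6 The transfer theorems -/

/-- **Mod-`p` congruence of the (Σ-imprimitive) Sprung pairs of congruent forms.** In the setting of
`sprung_congr_of_isSprungPair_of_mazurTate_congr` with `p ∣ a₁`, `p ∣ a₂`:
`L♯₁·P₁ ≡ c·L♯₂·P₂` and `L♭₁·P₁ ≡ c·L♭₂·P₂ (mod pΛ)`. For an X8 curve (`p = 3`, `a_3 = ±3`) and a
`3`-congruent curve with `a_3 = 0` (whose Sprung pair is Pollack's `(L⁺, L⁻)`): Sprung's `L♯, L♭`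
are congruent mod `3` to Pollack's `L⁺, L⁻` of the partner, Σ-imprimitively. The hypothesis `hMT`
(congruence of Mazur–Tate elements after Σ-stabilisation, with the period unit `c`) is DISPLAYED,
never asserted here; in print it is the congruence of canonical-period modular symbols of congruent
forms (Vatsal, Duke Math. J. 98 (1999) Thm. 1.10; Emerton–Pollack–Weston, Invent. Math. 163 (2006)
§3) with the Néron/canonical period comparison (Greenberg–Vatsal 2000 Rem. 3.4) — see the module
docstring for the exact printed scopes. [cite: Sprung2017, §4 Cor. 4.4 and Thm. 1.12] -/
theorem C_dvd_sub_of_isSprungPair_of_mazurTate_congr {N₁ N₂ : ℕ}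
    (f₁ : CuspForm (Gamma0 N₁) 2) (f₂ : CuspForm (Gamma0 N₂) 2) {a₁ a₂ : ℤ}
    (ha₁ : (p : ℤ) ∣ a₁) (ha₂ : (p : ℤ) ∣ a₂)
    {Ls₁ Lf₁ Ls₂ Lf₂ : IwasawaAlgebra p} (h₁ : IsSprungPair f₁ p a₁ Ls₁ Lf₁)
    (h₂ : IsSprungPair f₂ p a₂ Ls₂ Lf₂) (P₁ P₂ : IwasawaAlgebra p) (c : ℤ_[p])
    (hMT : ∀ n : ℕ, ∃ q r : IwasawaAlgebra p,
      ((mazurTateElement f₁ p n).map (algebraMap ℚ ℚ_[p]) : PowerSeries ℚ_[p]) *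
            iwasawaToPowerSeries p P₁ -
          iwasawaToPowerSeries p (PowerSeries.C c) *
            (((mazurTateElement f₂ p n).map (algebraMap ℚ ℚ_[p]) : PowerSeries ℚ_[p]) *
              iwasawaToPowerSeries p P₂) =
        iwasawaToPowerSeries p
          (toIwasawa p (cyclotomicOmega p n) * q + PowerSeries.C (p : ℤ_[p]) * r)) :
    PowerSeries.C (p : ℤ_[p]) ∣ (Ls₁ * P₁ - PowerSeries.C c * (Ls₂ * P₂)) ∧
      PowerSeries.C (p : ℤ_[p]) ∣ (Lf₁ * P₁ - PowerSeries.C c * (Lf₂ * P₂)) :=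
  C_dvd_sub_of_sprung_congr ha₁ ha₂ c
    (sprung_congr_of_isSprungPair_of_mazurTate_congr f₁ f₂ h₁ h₂ P₁ P₂ c hMT)

/-- **The analytic `μ`-transfer (unit content of `L♯`, `L♭` passes between congruent forms).** In the
setting of `C_dvd_sub_of_isSprungPair_of_mazurTate_congr` with `c ∈ ℤ_pˣ` and multipliers `P₁, P₂`
of unit content (Σ-imprimitive Euler factors): for each colour `•`,
`μ(L•₁) = 0 ⟺ μ(L•₂) = 0` (as `HasUnitContent`). This is the role of Corpuz–Lei arXiv:2508.09733
Thm. 1 (= Thm. 5.3) in the cell's «CM-congruence transfer» lines L5-CM (X8) / L4-CM (X7 small image,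
`a₁ = a₂ = 0`), here a theorem of the tree modulo the displayed congruence `hMT`.
[cite: Sprung2017, §4 Cor. 4.4 and Thm. 1.12] [cite: GreenbergVatsal2000, p. 2, (2)] -/
theorem hasUnitContent_chromaticL_iff_of_mazurTate_congr {N₁ N₂ : ℕ}
    (f₁ : CuspForm (Gamma0 N₁) 2) (f₂ : CuspForm (Gamma0 N₂) 2) {a₁ a₂ : ℤ}
    (ha₁ : (p : ℤ) ∣ a₁) (ha₂ : (p : ℤ) ∣ a₂)
    {Ls₁ Lf₁ Ls₂ Lf₂ : IwasawaAlgebra p} (h₁ : IsSprungPair f₁ p a₁ Ls₁ Lf₁)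
    (h₂ : IsSprungPair f₂ p a₂ Ls₂ Lf₂) {P₁ P₂ : IwasawaAlgebra p} (hP₁ : HasUnitContent P₁)
    (hP₂ : HasUnitContent P₂) {c : ℤ_[p]} (hc : IsUnit c)
    (hMT : ∀ n : ℕ, ∃ q r : IwasawaAlgebra p,
      ((mazurTateElement f₁ p n).map (algebraMap ℚ ℚ_[p]) : PowerSeries ℚ_[p]) *
            iwasawaToPowerSeries p P₁ -
          iwasawaToPowerSeries p (PowerSeries.C c) *
            (((mazurTateElement f₂ p n).map (algebraMap ℚ ℚ_[p]) : PowerSeries ℚ_[p]) *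
              iwasawaToPowerSeries p P₂) =
        iwasawaToPowerSeries p
          (toIwasawa p (cyclotomicOmega p n) * q + PowerSeries.C (p : ℤ_[p]) * r))
    (col : Chroma) :
    HasUnitContent (chromaticL col Ls₁ Lf₁) ↔ HasUnitContent (chromaticL col Ls₂ Lf₂) := by
  obtain ⟨hs, hf⟩ := C_dvd_sub_of_isSprungPair_of_mazurTate_congr f₁ f₂ ha₁ ha₂ h₁ h₂ P₁ P₂ c hMT
  cases col with
  | sharp =>
    rw [chromaticL_sharp, chromaticL_sharp, ← hasUnitContent_mul_iff_of_hasUnitContent (x := Ls₁) hP₁,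
      ← hasUnitContent_mul_iff_of_hasUnitContent (x := Ls₂) hP₂]
    exact hasUnitContent_iff_of_C_dvd_sub hc hs
  | flat =>
    rw [chromaticL_flat, chromaticL_flat, ← hasUnitContent_mul_iff_of_hasUnitContent (x := Lf₁) hP₁,
      ← hasUnitContent_mul_iff_of_hasUnitContent (x := Lf₂) hP₂]
    exact hasUnitContent_iff_of_C_dvd_sub hc hf

/-- **The analytic `λ`-transfer (Σ-imprimitive `λ`-invariants agree).** In the same setting, when
`μ = 0` on one (hence both) sides, `λ(L•₁·P₁) = λ(L•₂·P₂)` for each colour — the `λ`-invariants of the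
Σ-imprimitive functions agree (those of `L•₁`, `L•₂` themselves then differ by the `λ`'s of the
Euler-factor multipliers, the Greenberg–Vatsal / Emerton–Pollack–Weston correction terms).
[cite: GreenbergVatsal2000, p. 2–3, (1)–(2)] [cite: Sprung2017, §4 Cor. 4.4 and Thm. 1.12] -/
theorem lam_chromaticL_mul_eq_of_mazurTate_congr {N₁ N₂ : ℕ}
    (f₁ : CuspForm (Gamma0 N₁) 2) (f₂ : CuspForm (Gamma0 N₂) 2) {a₁ a₂ : ℤ}
    (ha₁ : (p : ℤ) ∣ a₁) (ha₂ : (p : ℤ) ∣ a₂)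
    {Ls₁ Lf₁ Ls₂ Lf₂ : IwasawaAlgebra p} (h₁ : IsSprungPair f₁ p a₁ Ls₁ Lf₁)
    (h₂ : IsSprungPair f₂ p a₂ Ls₂ Lf₂) (P₁ P₂ : IwasawaAlgebra p) {c : ℤ_[p]} (hc : IsUnit c)
    (hMT : ∀ n : ℕ, ∃ q r : IwasawaAlgebra p,
      ((mazurTateElement f₁ p n).map (algebraMap ℚ ℚ_[p]) : PowerSeries ℚ_[p]) *
            iwasawaToPowerSeries p P₁ -
          iwasawaToPowerSeries p (PowerSeries.C c) *
            (((mazurTateElement f₂ p n).map (algebraMap ℚ ℚ_[p]) : PowerSeries ℚ_[p]) *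
              iwasawaToPowerSeries p P₂) =
        iwasawaToPowerSeries p
          (toIwasawa p (cyclotomicOmega p n) * q + PowerSeries.C (p : ℤ_[p]) * r))
    (col : Chroma) (hμ : HasUnitContent (chromaticL col Ls₁ Lf₁ * P₁)) :
    lam (chromaticL col Ls₁ Lf₁ * P₁) = lam (chromaticL col Ls₂ Lf₂ * P₂) := by
  obtain ⟨hs, hf⟩ := C_dvd_sub_of_isSprungPair_of_mazurTate_congr f₁ f₂ ha₁ ha₂ h₁ h₂ P₁ P₂ c hMT
  cases col with
  | sharp =>
    rw [chromaticL_sharp] at hμ ⊢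
    rw [chromaticL_sharp]
    exact lam_eq_of_C_dvd_sub hc hs hμ
  | flat =>
    rw [chromaticL_flat] at hμ ⊢
    rw [chromaticL_flat]
    exact lam_eq_of_C_dvd_sub hc hf hμ

end ChromaticCongruence
/-! ### §7 The cell's currency: the `μ`-node of an X8 curve from the `μ`-node of an `a_p = 0` partner -/

section Partner

open ChromaticCongruence

variable {p : ℕ} [hp : Fact p.Prime]

/-- **`L•₁ ≠ 0 ∧ μ(L•₁) = 0` for a supersingular form/curve (e.g. an X8 curve: `p = 3`, `a_3 = ±3`) FROM
the signed `μ`-node `SignedMuVanishing W₂ p` of a `p`-congruent supersingular partner `W₂` (e.g. `a_p = 0`,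
CM), modulo the displayed congruence `hMT` of Σ-imprimitive Mazur–Tate elements** (unit-content
multipliers `P₁, P₂`, unit `c`; `f₂` the newform of `W₂`, `f₁` any weight-two form with a Sprung pair at a
trace `a₁`, `p ∣ a₁`). CONDITIONAL on `hMT` (printed scopes: module docstring); closes nothing.
[cite: Sprung2017, §4 Cor. 4.4 and Thm. 1.12] [cite: GreenbergVatsal2000, p. 2, (2)]
[cite: PerrinRiou2003, §6.1 Conjecture 6.1.1] -/
theorem chromaticL_ne_zero_and_mu_eq_zero_of_partner_of_mazurTate_congr
    {W₂ : WeierstrassCurve ℚ} [W₂.IsElliptic] [W₂.IsGloballyMinimal] [NeZero (W₂.conductorNorm ℤ)]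
    (hμ₂ : SignedMuVanishing W₂ p) (f₂ : CuspForm (Gamma0 (W₂.conductorNorm ℤ)) 2)
    (hf₂ : IsNewformOf W₂ f₂) (ha₂ : (p : ℤ) ∣ W₂.frobeniusTrace p)
    {N₁ : ℕ} (f₁ : CuspForm (Gamma0 N₁) 2) {a₁ : ℤ} (ha₁ : (p : ℤ) ∣ a₁)
    {Ls₁ Lf₁ Ls₂ Lf₂ : IwasawaAlgebra p} (h₁ : IsSprungPair f₁ p a₁ Ls₁ Lf₁)
    (h₂ : IsSprungPair f₂ p (W₂.frobeniusTrace p) Ls₂ Lf₂)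
    {P₁ P₂ : IwasawaAlgebra p} (hP₁ : HasUnitContent P₁) (hP₂ : HasUnitContent P₂)
    {c : ℤ_[p]} (hc : IsUnit c)
    (hMT : ∀ n : ℕ, ∃ q r : IwasawaAlgebra p,
      ((mazurTateElement f₁ p n).map (algebraMap ℚ ℚ_[p]) : PowerSeries ℚ_[p]) *
            iwasawaToPowerSeries p P₁ -
          iwasawaToPowerSeries p (PowerSeries.C c) *
            (((mazurTateElement f₂ p n).map (algebraMap ℚ ℚ_[p]) : PowerSeries ℚ_[p]) *
              iwasawaToPowerSeries p P₂) =
        iwasawaToPowerSeries p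
          (toIwasawa p (cyclotomicOmega p n) * q + PowerSeries.C (p : ℤ_[p]) * r))
    (col : Chroma) :
    chromaticL col Ls₁ Lf₁ ≠ 0 ∧ mu (chromaticL col Ls₁ Lf₁) = 0 := by
  obtain ⟨hne₂, hμ₂'⟩ := hμ₂ f₂ hf₂ Ls₂ Lf₂ h₂ col
  have hU₂ : HasUnitContent (chromaticL col Ls₂ Lf₂) := hasUnitContent_of_mu_eq_zero hne₂ hμ₂'
  have hU₁ : HasUnitContent (chromaticL col Ls₁ Lf₁) :=
    (hasUnitContent_chromaticL_iff_of_mazurTate_congr f₁ f₂ ha₁ ha₂ h₁ h₂ hP₁ hP₂ hc hMT col).mpr hU₂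
  exact ⟨ne_zero_of_hasUnitContent hU₁, mu_eq_zero_of_hasUnitContent hU₁⟩

/-- **The `μ`-NODE of `W₁` from the `μ`-node of a congruent partner `W₂`:** for conductor-level newforms
`f₁, f₂`, an odd `p` with `p ∣ a_p(W₁)` and `GoodSS W₂ p`, unit-content multipliers, a unit `c` and the
displayed congruence `hMT`: `SignedMuVanishing W₂ p ⟹ SignedMuVanishing W₁ p` (newform uniqueness
`IsNewformOf.unique`; the partner's pair exists by `thm112_exists_isSprungPair_holds`). CONDITIONAL on `hMT`;
closes nothing. [cite: Sprung2017, Thm. 1.12 and §4 Cor. 4.4] [cite: PerrinRiou2003, §6.1 Conjecture 6.1.1] -/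
theorem signedMuVanishing_of_partner_of_mazurTate_congr
    {W₁ W₂ : WeierstrassCurve ℚ} [W₁.IsElliptic] [W₁.IsGloballyMinimal] [W₂.IsElliptic]
    [W₂.IsGloballyMinimal] [NeZero (W₁.conductorNorm ℤ)] [NeZero (W₂.conductorNorm ℤ)]
    (hp2 : p ≠ 2) (hμ₂ : SignedMuVanishing W₂ p)
    (f₁ : CuspForm (Gamma0 (W₁.conductorNorm ℤ)) 2) (hf₁ : IsNewformOf W₁ f₁)
    (f₂ : CuspForm (Gamma0 (W₂.conductorNorm ℤ)) 2) (hf₂ : IsNewformOf W₂ f₂)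
    (ha₁ : (p : ℤ) ∣ W₁.frobeniusTrace p) (hss₂ : GoodSS W₂ p)
    {P₁ P₂ : IwasawaAlgebra p} (hP₁ : HasUnitContent P₁) (hP₂ : HasUnitContent P₂)
    {c : ℤ_[p]} (hc : IsUnit c)
    (hMT : ∀ n : ℕ, ∃ q r : IwasawaAlgebra p,
      ((mazurTateElement f₁ p n).map (algebraMap ℚ ℚ_[p]) : PowerSeries ℚ_[p]) *
            iwasawaToPowerSeries p P₁ -
          iwasawaToPowerSeries p (PowerSeries.C c) *
            (((mazurTateElement f₂ p n).map (algebraMap ℚ ℚ_[p]) : PowerSeries ℚ_[p]) *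
              iwasawaToPowerSeries p P₂) =
        iwasawaToPowerSeries p
          (toIwasawa p (cyclotomicOmega p n) * q + PowerSeries.C (p : ℤ_[p]) * r)) :
    SignedMuVanishing W₁ p := by
  intro _ f hf Ls Lf hSP col
  have hff : f = f₁ := hf.unique hf₁
  subst hff
  obtain ⟨Ls₂, Lf₂, h₂⟩ :=
    thm112_exists_isSprungPair_holds (W := W₂) (f := f₂) (p := p) hp2 hf₂ hss₂.1 hss₂.2
  exact chromaticL_ne_zero_and_mu_eq_zero_of_partner_of_mazurTate_congr hμ₂ f₂ hf₂ hss₂.2 f ha₁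
    hSP h₂ hP₁ hP₂ hc hMT col

/-- **X8 form.** For an X8 curve `W₁` (`ClassX8 W₁ p`: `p = 3`, good supersingular, `a_3 = ±3`) and a
good supersingular partner `W₂` at `3` (in L5-CM a `3`-congruent CM curve with `a_3 = 0`, whose node is a
THEOREM in the unit case, p432145, or a two-engine certified row), `hMT` transports the `μ`-node:
`SignedMuVanishing W₁ 3`, i.e. `μ(L♯_3(E)) = μ(L♭_3(E)) = 0` (Perrin-Riou Conj. 6.1.1 at `(E, 3)`). The
Corpuz–Lei PRE binder (p427325) is not used. CONDITIONAL on `hMT` and the partner's node; closes nothing.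
[cite: Sprung2017, Thm. 1.12 and §4 Cor. 4.4] [cite: PerrinRiou2003, §6.1 Conjecture 6.1.1] -/
theorem X8.signedMuVanishing_of_partner_of_mazurTate_congr
    {W₁ W₂ : WeierstrassCurve ℚ} [W₁.IsElliptic] [W₁.IsGloballyMinimal] [W₂.IsElliptic]
    [W₂.IsGloballyMinimal] [NeZero (W₁.conductorNorm ℤ)] [NeZero (W₂.conductorNorm ℤ)]
    (hX : ClassX8 W₁ p) (hμ₂ : SignedMuVanishing W₂ p)
    (f₁ : CuspForm (Gamma0 (W₁.conductorNorm ℤ)) 2) (hf₁ : IsNewformOf W₁ f₁)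
    (f₂ : CuspForm (Gamma0 (W₂.conductorNorm ℤ)) 2) (hf₂ : IsNewformOf W₂ f₂)
    (hss₂ : GoodSS W₂ p)
    {P₁ P₂ : IwasawaAlgebra p} (hP₁ : HasUnitContent P₁) (hP₂ : HasUnitContent P₂)
    {c : ℤ_[p]} (hc : IsUnit c)
    (hMT : ∀ n : ℕ, ∃ q r : IwasawaAlgebra p,
      ((mazurTateElement f₁ p n).map (algebraMap ℚ ℚ_[p]) : PowerSeries ℚ_[p]) *
            iwasawaToPowerSeries p P₁ -
          iwasawaToPowerSeries p (PowerSeries.C c) *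
            (((mazurTateElement f₂ p n).map (algebraMap ℚ ℚ_[p]) : PowerSeries ℚ_[p]) *
              iwasawaToPowerSeries p P₂) =
        iwasawaToPowerSeries p
          (toIwasawa p (cyclotomicOmega p n) * q + PowerSeries.C (p : ℤ_[p]) * r)) :
    SignedMuVanishing W₁ p := by
  obtain ⟨hp3, hss₁, _⟩ := hX
  subst hp3
  exact signedMuVanishing_of_partner_of_mazurTate_congr (by decide) hμ₂ f₁ hf₁ f₂ hf₂ hss₁.2 hss₂
    hP₁ hP₂ hc hMT

end Partner

end Summit.BirchSwinnertonDyer.BirchSwinnertonDyer.Theorems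

end
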